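import Summits.HodgeConjecture.CorCM.GaloisSkewSectionClasses
import Summits.HodgeConjecture.CorCM.GaloisNonCentralInvolution
import HarnessLib

/-!
# A non-central involution with a good CLASS COUNT makes the field BAD — Galois dress of the small-order skew theorem

COR-CM (cell `pub-hodgecm2`), binder seat b04 (gen 36), count-neutral own lane «Galois-CM-type classification».  KERNEL ONLY:
theorems; no definition, no named fact, no `sorry`.  `HC_CM` is neither used nor claimed.  Galois dress of
`CorCM/GaloisSkewSectionClasses` (`SkewSection.exists_skew_of_noncentral_involution_classes`) through gen 23's
`GaloisModels.exists_simple_degenerate_of_model_skew` (a CM set with trivial left and non-trivial right stabiliser is read by a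
PRIMITIVE DEGENERATE CM type): for a Galois CM field `K` of degree `2^m`, a model `e : Gal(K/ℚ) ≃* G₀`, `c₀ = e(c)`, and a
non-central involution `u ∈ G₀` with

  `I'·2^(n/2) + [u ≁ c₀u]·|u^G₀|·2^((n + |C(u)|/4)/2) < 2^n`   (`n = |G₀|/4`, `I'` = involutions outside `{1,c₀} ∪ u^G₀ ∪ (c₀u)^G₀`)

— a condition `decide`d on every table model of order `32` — `K` carries a SIMPLE DEGENERATE abelian variety of dimension `|G₀|/2`
with CM by `K` (an exceptional Hodge class on a power): **`exists_simple_degenerate_of_noncentral_involution_classes`**, and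
`…_classes_gal` on `Gal(K/ℚ)` itself.  Gen 32's theorem is the case `|G₀| ≥ 64`, where the count is automatic.

## References

* [Shimura1998] G. Shimura, *Abelian Varieties with Complex Multiplication and Modular Functions*, §6.2 Thm. 3, §8.2 Prop. 26, §32.10.
* [Gordon1999HodgeAVSurvey] B. B. Gordon, *A survey of the Hodge conjecture for abelian varieties*, Thm. 6.4, §9.3.
-/

noncomputable section

open CategoryTheory CategoryTheory.Limits NumberField
open scoped BigOperators

namespace Summit.HodgeConjecture.CorCM.GaloisModels

open Literature.NumberTheory.ComplexMultiplication
open Literature.AlgebraicGeometry.Motives (AbelianVariety CMType)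
open Literature.AlgebraicGeometry.HodgeTheory
open Literature.AlgebraicGeometry.ComplexMultiplication (IsCMTypeRealisation)
open Literature.AlgebraicGeometry.Pohlmann1968
open Literature.Barriers.HodgeConjecture (divisorClassesSpan)
open Summit.HodgeConjecture.CorCM.GaloisRank

variable {K : Type} [Field K] [NumberField K] [IsCMField K] [IsGalois ℚ K]

/-- In a group of order `2^m` every `v ≠ 1` has a power which is an involution. [folklore] -/
theorem exists_pow_involution_of_card_two_pow {G₀ : Type*} [Group G₀] [Fintype G₀] {m : ℕ}
    (hcard : Fintype.card G₀ = 2 ^ m) (v : G₀) (hv : v ≠ 1) : ∃ j : ℕ, v ^ j ≠ 1 ∧ v ^ j * v ^ j = 1 := by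
  have hdvd : orderOf v ∣ 2 ^ m := by rw [← hcard]; exact orderOf_dvd_card
  obtain ⟨i, -, hi⟩ := (Nat.dvd_prime_pow Nat.prime_two).1 hdvd
  have hi0 : i ≠ 0 := by
    rintro rfl
    rw [pow_zero] at hi
    exact hv (orderOf_eq_one_iff.1 hi)
  obtain ⟨i', rfl⟩ : ∃ i', i = i' + 1 := ⟨i - 1, by omega⟩
  refine ⟨2 ^ i', ?_, ?_⟩
  · intro h
    have h1 : orderOf v ∣ 2 ^ i' := orderOf_dvd_of_pow_eq_one h
    rw [hi] at h1
    have := Nat.le_of_dvd (by positivity) h1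
    have h2 : 2 ^ i' < 2 ^ (i' + 1) := Nat.pow_lt_pow_right (by norm_num) (by omega)
    omega
  · rw [← pow_add, ← two_mul, ← pow_succ', ← hi]
    exact pow_orderOf_eq_one v

/-- **A NON-CENTRAL INVOLUTION WITH A GOOD CLASS COUNT MAKES THE FIELD BAD** (model form, `|G₀| = 2^m`).  `e : Gal(K/ℚ) ≃* G₀`,
`c₀ = e(c)`, `u ∈ G₀` a non-central involution with
`I'·2^(n/2) + [u ≁ c₀u]·|u^G₀|·2^((n + |C(u)|/4)/2) < 2^n` (`n = |G₀|/4`, `I'` = the involutions outside `{1, c₀} ∪ u^G₀ ∪ (c₀u)^G₀`)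
⟹ `K` carries a SIMPLE DEGENERATE abelian variety of dimension `|G₀|/2` with CM by `K` and a rational `(p,p)` class outside the
divisor ring on some power. [cite: Shimura1998, §6.2 Thm. 3, §8.2 Prop. 26 and §32.10] [cite: Gordon1999HodgeAVSurvey, Thm. 6.4 and §9.3] -/
theorem exists_simple_degenerate_of_noncentral_involution_classes {G₀ : Type*} [Group G₀] [Fintype G₀] [DecidableEq G₀]
    (e : (K ≃ₐ[ℚ] K) ≃* G₀) (c₀ : G₀) (hc : e ((IsCMField.complexConj K).restrictScalars ℚ) = c₀) {m : ℕ}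
    (hcard : Fintype.card G₀ = 2 ^ m) (u : G₀) (huu : u * u = 1) (hnc : ∃ g : G₀, g * u ≠ u * g)
    (hcount : (Finset.univ.filter fun v : G₀ => v * v = 1 ∧ v ≠ 1 ∧ v ≠ c₀ ∧ (∀ g : G₀, g * u * g⁻¹ ≠ v) ∧
        (∀ g : G₀, g * u * g⁻¹ ≠ c₀ * v)).card * 2 ^ (Fintype.card G₀ / 4 / 2) +
      (if ∃ g : G₀, g * u * g⁻¹ = c₀ * u then 0 else
        (Finset.univ.filter fun v : G₀ => ∃ g : G₀, g * u * g⁻¹ = v).card *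
          2 ^ ((Fintype.card G₀ / 4 + (Finset.univ.filter fun g : G₀ => g * u = u * g).card / 4) / 2)) <
      2 ^ (Fintype.card G₀ / 4)) :
    ∃ (Φ : CMType K) (φ₀ : K →+* ℂ) (A : AbelianVariety ℂ) (ι : 𝓞 K →+* End A)
      (θ : K →+* Module.End ℂ (complexBetti A.X 1)),
      IsPrimitive (ℂ ≃+* ℂ) Φ.1 φ₀ ∧ ¬ IsNondegenerate Φ ∧ IsCMTypeRealisation Φ A ι θ ∧ A.IsSimple ∧
      A.dim = Fintype.card G₀ / 2 ∧
      ∃ n p : ℕ, ∃ x : complexBetti (⨁ fun _ : Fin n => A).X (2 * p), IsRationalClass x ∧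
        IsOfHodgeType (⨁ fun _ : Fin n => A).dim (⨁ fun _ : Fin n => A).X (2 * p) p p x ∧
        x ∉ divisorClassesSpan (⨁ fun _ : Fin n => A).X (⨁ fun _ : Fin n => A).dim p := by
  classical
  have hcc : c₀ * c₀ = 1 := model_complexConj_mul_self e hc
  have hc1 : c₀ ≠ 1 := model_complexConj_ne_one e hc
  have hcen : ∀ g : G₀, c₀ * g = g * c₀ := model_complexConj_comm e hc
  have hu1 : u ≠ 1 := fun h => by obtain ⟨g, hg⟩ := hnc; exact hg (by rw [h, mul_one, one_mul])
  obtain ⟨T, hcm, hprim, hTu⟩ :=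
    SkewSection.exists_skew_of_noncentral_involution_classes c₀ u hcc hc1 hcen huu hu1 hnc
      (exists_pow_involution_of_card_two_pow hcard) hcount
  exact exists_simple_degenerate_of_model_skew e c₀ hc T hcm hprim hu1 hTu

/-- **… on `Gal(K/ℚ)` itself** (`[K:ℚ] = 2^m`): a non-central involution `σ ∈ Gal(K/ℚ)` whose class count satisfies the inequality
⟹ `K` carries a SIMPLE DEGENERATE abelian variety of dimension `[K:ℚ]/2` with CM by `K`.
[cite: Shimura1998, §6.2 Thm. 3, §8.2 Prop. 26 and §32.10] [cite: Gordon1999HodgeAVSurvey, Thm. 6.4 and §9.3] -/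
theorem exists_simple_degenerate_of_noncentral_involution_classes_gal [DecidableEq (K ≃ₐ[ℚ] K)] {m : ℕ}
    (hdeg : Module.finrank ℚ K = 2 ^ m)
    (σ : K ≃ₐ[ℚ] K) (hσ : σ * σ = 1) (hnc : ∃ τ : K ≃ₐ[ℚ] K, τ * σ ≠ σ * τ)
    (hcount : (Finset.univ.filter fun v : K ≃ₐ[ℚ] K => v * v = 1 ∧ v ≠ 1 ∧
        v ≠ (IsCMField.complexConj K).restrictScalars ℚ ∧ (∀ g : K ≃ₐ[ℚ] K, g * σ * g⁻¹ ≠ v) ∧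
        (∀ g : K ≃ₐ[ℚ] K, g * σ * g⁻¹ ≠ (IsCMField.complexConj K).restrictScalars ℚ * v)).card *
          2 ^ (Module.finrank ℚ K / 4 / 2) +
      (if ∃ g : K ≃ₐ[ℚ] K, g * σ * g⁻¹ = (IsCMField.complexConj K).restrictScalars ℚ * σ then 0 else
        (Finset.univ.filter fun v : K ≃ₐ[ℚ] K => ∃ g : K ≃ₐ[ℚ] K, g * σ * g⁻¹ = v).card *
          2 ^ ((Module.finrank ℚ K / 4 +
            (Finset.univ.filter fun g : K ≃ₐ[ℚ] K => g * σ = σ * g).card / 4) / 2)) <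
      2 ^ (Module.finrank ℚ K / 4)) :
    ∃ (Φ : CMType K) (φ₀ : K →+* ℂ) (A : AbelianVariety ℂ) (ι : 𝓞 K →+* End A)
      (θ : K →+* Module.End ℂ (complexBetti A.X 1)),
      IsPrimitive (ℂ ≃+* ℂ) Φ.1 φ₀ ∧ ¬ IsNondegenerate Φ ∧ IsCMTypeRealisation Φ A ι θ ∧ A.IsSimple ∧
      A.dim = Module.finrank ℚ K / 2 ∧
      ∃ n p : ℕ, ∃ x : complexBetti (⨁ fun _ : Fin n => A).X (2 * p), IsRationalClass x ∧
        IsOfHodgeType (⨁ fun _ : Fin n => A).dim (⨁ fun _ : Fin n => A).X (2 * p) p p x ∧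
        x ∉ divisorClassesSpan (⨁ fun _ : Fin n => A).X (⨁ fun _ : Fin n => A).dim p := by
  have hcardK : Fintype.card (K ≃ₐ[ℚ] K) = 2 ^ m := by
    rw [card_model_eq_finrank (MulEquiv.refl (K ≃ₐ[ℚ] K))]; exact hdeg
  have hfin : Module.finrank ℚ K = Fintype.card (K ≃ₐ[ℚ] K) :=
    (card_model_eq_finrank (MulEquiv.refl (K ≃ₐ[ℚ] K))).symm
  rw [hfin] at hcount
  obtain ⟨Φ, φ₀, A, ι, θ, H1, H2, H3, H4, H5, H6⟩ :=
    exists_simple_degenerate_of_noncentral_involution_classes (MulEquiv.refl (K ≃ₐ[ℚ] K)) _ rfl hcardK σ hσ hnc hcount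
  refine ⟨Φ, φ₀, A, ι, θ, H1, H2, H3, H4, ?_, H6⟩
  rw [H5, card_model_eq_finrank (MulEquiv.refl (K ≃ₐ[ℚ] K))]

end Summit.HodgeConjecture.CorCM.GaloisModels

end
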